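import Literature.Analysis.FluidPDE.EllipticalInstability
import HarnessLib

/-!
# Waleffe's solid-body-rotation mode of the unbounded strained vortex (Kerswell 2002, eq. (2.2)):
# an exact Navier–Stokes solution whose perturbation vorticity grows at the FULL strain rate `ε`

HONEST FRAMING (cell `pub/ns-blowup`, seat `ns-blowup-lit3` g7; D-0074, bears_on LADDER-NS N1*
RATE-AUDIT row R3 / LIT-DOSSIER §47 row 4 «Bayly 1986 / Kerswell 2002 elliptic-instability rates»).
Statements about an EXACT but UNBOUNDED (infinite-energy, linear-in-`x`) solution of the
Navier–Stokes equations on `ℝ³`. WHAT THIS IS NOT: not a statement about the Navier–Stokes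
regularity problem; nothing here is evidence of blow-up or of regularity.

## Source (held) and what is typed

R. R. Kerswell, *Elliptical instability*, Annu. Rev. Fluid Mech. **34** (2002) 83–113, **§2.1 "An
Unbounded Strained Vortex"**, p. 86 [held: `paper:url-fbc73a441d58`, cell render
`renders/paper-doi-10-1146-annurev-fluid-34-081701-171829-Kerswell2002/p0004.txt` L3–22]:

> "The simplest example of an elliptical instability is found within the context of an unbounded
> strained vortex, which is defined as the flow `U := [[0, −1−ε, 0], [1−ε, 0, 0], [0, 0, 0]] x
> = A·x` (2.1), where the vorticity is `2ẑ` everywhere, `ε > 0` is the strain rate with stretching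
> in the `−45°` direction, and `ε < 1` for elliptical flow. Waleffe (1990) realized that a simple
> solid-body rotation, `u = ½ ω × x`, represents an exact nonlinear solution of the perturbation
> equations, providing that `ω̇₁ = −εω₂, ω̇₂ = −εω₁` (2.2). This system has an exponentially
> growing eigenmode (`ω₁ = −ω₂`), with growth rate `ε` whose vorticity sits permanently in the
> stretching direction at `−45°` to the `x` axis. Although the growing perturbation is unbounded at
> infinity in both space and time, it nevertheless suggested an intuitively appealing mechanism
> for the instability observed by Pierrehumbert and Bayly."

TYPED (namespace `Literature.Analysis.FluidPDE.EllipticalInstability`, reusing the tree's strained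
vortex `gradMatrix γ ε` / `strain ε` / `baseVelocity γ ε` — Kerswell normalises the rotation rate to
`γ = 1`; here `γ` is kept general, as in Saffman §12.4 and the rest of the tree's story — and
Majda–Bertozzi's exact linear flows `RotatingStrain.velocity` / `pressure` / Prop. 1.5
`RotatingStrain.isClassicalNSSolutionOn`):
* `lin_strain_apply` — (2.2) is the ODE `ω̇ = 𝒟 ω` of Majda–Bertozzi (1.23) for the CONSTANT strain
  `𝒟 = strain ε`: `𝒟 ω = (−εω₂, −εω₁, 0)` (indices `0, 1, 2` in Lean);
* `isClassicalNSSolutionOn_baseVelocity_add_solidBody` — for EVERY solution `ω` of (2.2)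
  (`ω̇ = 𝒟 ω`, third component constant) and every viscosity `ν`, the flow
  `U(x) + ½ ω(t) × x = ½ (2γ e₃ + ω(t)) × x + 𝒟 x` with Majda–Bertozzi's quadratic pressure is a
  classical Navier–Stokes solution on `ℝ × ℝ³` — "an exact nonlinear solution of the perturbation
  equations"; `curl` of it is `2γ e₃ + ω(t)` (`curl_baseVelocity_add_solidBody`);
* the growing eigenmode `solidBodyVorticity c ε t = c e^{εt} (e₁ − e₂)`: `lin_strain_stretchDir`
  (`𝒟 (e₁ − e₂) = ε (e₁ − e₂)`: the `−45°` diagonal IS the stretching direction),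
  `hasDerivAt_solidBodyVorticity` (it solves (2.2)), `solidBodyFlow` / `solidBodyPressure`,
  **`isClassicalNSSolutionOn_solidBodyFlow`** (exact NS solution for every `ν`, `γ`, `c`, `ε`),
  `solidBodyFlow_eq` (`= baseVelocity γ ε x + ½ ω(t) × x`), `curl_solidBodyFlow`,
  **`norm_solidBodyVorticity`** (`‖ω(t)‖ = √2 |c| e^{εt}`: growth rate EXACTLY `ε`), and
  `norm_curl_solidBodyFlow_sub_curl_base` (the perturbation vorticity of the exact solution has
  size `√2|c|e^{εt}` at every point);
* the decaying eigenmode `c e^{−εt}(e₁ + e₂)` (`hasDerivAt_solidBodyVorticityDecay`) for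
  completeness of (2.2)'s phase portrait.

READING for the cell (RATE-AUDIT R3): the tree's strain-rate CEILING for Kelvin modes of the
strained vortex, `IsKelvinMode.norm_le_exp` (`‖v(t)‖ ≤ ‖v(0)‖e^{εt}`, `EllipticalInstability.lean`
§3), and the Kelvin-mode OPTIMUM `(9/16)ε + o(ε)` (`NineSixteenthsLaw_holds`) concern BOUNDED
plane-wave perturbations; Waleffe's (2.2) shows the ceiling rate `ε` itself is realised by an exact —
but spatially unbounded — perturbation whose vorticity is locked to the stretching direction. No
claim beyond the printed one is made; in particular nothing here is a growth rate of a
finite-energy disturbance.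

## References

* R. R. Kerswell, Annu. Rev. Fluid Mech. 34 (2002) 83–113, §2.1 eqs. (2.1)–(2.2), p. 86.
  [`Kerswell2002`]
* F. Waleffe, Phys. Fluids A 2 (1990) 76–80 (cite-only; the observation (2.2) is attributed to it
  by Kerswell). [`Waleffe1990`]
* A. J. Majda, A. L. Bertozzi, *Vorticity and Incompressible Flow*, CUP 2002, §1.4 Prop. 1.5
  eqs. (1.23)–(1.24) (tree: `RotatingStrainFlows.lean`). [`MajdaBertozziCUP2002`]
* P. G. Saffman, *Vortex Dynamics*, CUP 1992, §12.4 eqs. (1)–(2) (tree: `EllipticalInstability.lean`).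
  [`Saffman1992`]
-/

noncomputable section

open Real Set Function InnerProductSpace
open scoped RealInnerProductSpace Topology

namespace Literature.Analysis.FluidPDE

namespace EllipticalInstability

open RotatingStrain

/-! ### §1 Equation (2.2) is Majda–Bertozzi's `ω̇ = 𝒟ω` for the constant strain `𝒟 = strain ε` -/

/-- The strain part of the strained vortex acts as `𝒟 ω = (−ε ω₂, −ε ω₁, 0)`: Kerswell's (2.2)
`ω̇₁ = −εω₂, ω̇₂ = −εω₁` (and `ω̇₃ = 0`) is the vorticity ODE `ω̇ = 𝒟ω` of Majda–Bertozzi (1.23)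
for the constant matrix `𝒟 = strain ε`. [cite: Kerswell2002, §2.1 eq. (2.2) p. 86] -/
theorem lin_strain_apply (ε : ℝ) (v : EuclideanSpace ℝ (Fin 3)) :
    lin (strain ε) v = !₂[-ε * v 1, -ε * v 0, 0] := by
  ext i
  fin_cases i <;> simp [lin_apply, strain, Fin.sum_univ_three]

/-- The base vorticity `2γ e₃` is in the kernel of the strain: `𝒟 (2γ e₃) = 0`.
[cite: Kerswell2002, §2.1 eq. (2.1) p. 86] -/
theorem lin_strain_baseVorticity (γ ε : ℝ) :
    lin (strain ε) ((2 * γ) • EuclideanSpace.single (2 : Fin 3) (1 : ℝ)) = 0 := by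
  ext i
  fin_cases i <;> simp [lin_apply, strain]

/-- **"An exact nonlinear solution of the perturbation equations" — for EVERY solution of (2.2).**
If `ω : ℝ → ℝ³` solves `ω̇ = 𝒟 ω` (`𝒟 = strain ε`; componentwise (2.2) plus `ω̇₃ = 0`), then for
every rotation rate `γ` and EVERY viscosity `ν` the flow `U + ½ ω(t) × x = ½ (2γe₃ + ω(t)) × x + 𝒟x`,
with Majda–Bertozzi's quadratic pressure, is a classical Navier–Stokes solution on `ℝ × ℝ³`
(MB Prop. 1.5 with total vorticity `2γ e₃ + ω(t)`, which solves (1.23) because `𝒟(2γe₃) = 0`).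
[cite: Kerswell2002, §2.1 eqs. (2.1)–(2.2) p. 86; MajdaBertozziCUP2002, §1.4 Prop. 1.5 eqs. (1.23)–(1.24)] -/
theorem isClassicalNSSolutionOn_baseVelocity_add_solidBody (γ ε ν : ℝ) {ω : ℝ → EuclideanSpace ℝ (Fin 3)}
    (hω : ∀ t, HasDerivAt ω (lin (strain ε) (ω t)) t) :
    IsClassicalNSSolutionOn univ ν 0
      (velocity (fun _ => strain ε)
        (fun t => (2 * γ) • EuclideanSpace.single (2 : Fin 3) (1 : ℝ) + ω t))
      (pressure (fun _ => strain ε)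
        (fun t => (2 * γ) • EuclideanSpace.single (2 : Fin 3) (1 : ℝ) + ω t)) := by
  refine RotatingStrain.isClassicalNSSolutionOn (D := fun _ => strain ε)
    (w := fun t => (2 * γ) • EuclideanSpace.single (2 : Fin 3) (1 : ℝ) + ω t)
    (fun _ _ => contDiff_const) (fun _ => strain_isSymm ε) (fun _ => strain_trace ε) (fun t => ?_) ν
  have h := (hω t).const_add ((2 * γ) • EuclideanSpace.single (2 : Fin 3) (1 : ℝ))
  refine h.congr_deriv ?_
  rw [map_add, lin_strain_baseVorticity, zero_add]

/-- The velocity of that solution IS the strained vortex plus the solid-body rotation `½ ω(t) × x`.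
[cite: Kerswell2002, §2.1 eqs. (2.1)–(2.2) p. 86] -/
theorem velocity_baseVorticity_add (γ ε : ℝ) (ω : ℝ → EuclideanSpace ℝ (Fin 3)) (t : ℝ)
    (x : EuclideanSpace ℝ (Fin 3)) :
    velocity (fun _ => strain ε)
        (fun t => (2 * γ) • EuclideanSpace.single (2 : Fin 3) (1 : ℝ) + ω t) t x =
      baseVelocity γ ε x + (1 / 2 : ℝ) • cross (ω t) x := by
  have hb := congrFun (congrFun (baseVelocity_eq_velocity γ ε) t) x
  rw [hb]
  simp only [velocity]
  have hadd : cross ((2 * γ) • EuclideanSpace.single (2 : Fin 3) (1 : ℝ) + ω t) x =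
      cross ((2 * γ) • EuclideanSpace.single (2 : Fin 3) (1 : ℝ)) x + cross (ω t) x := by
    ext i; fin_cases i <;> simp [cross, cross_apply]
  rw [hadd, smul_add]
  abel

/-- Its vorticity is uniform in space: `curl (U + ½ ω(t) × ·) = 2γ e₃ + ω(t)`.
[cite: Kerswell2002, §2.1 eqs. (2.1)–(2.2) p. 86; MajdaBertozziCUP2002, §1.4 Prop. 1.5 (proof)] -/
theorem curl_baseVelocity_add_solidBody (γ ε : ℝ) (ω : ℝ → EuclideanSpace ℝ (Fin 3)) (t : ℝ)
    (x : EuclideanSpace ℝ (Fin 3)) :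
    curl (velocity (fun _ => strain ε)
        (fun t => (2 * γ) • EuclideanSpace.single (2 : Fin 3) (1 : ℝ) + ω t) t) x =
      (2 * γ) • EuclideanSpace.single (2 : Fin 3) (1 : ℝ) + ω t :=
  curl_velocity (D := fun _ => strain ε) (strain_isSymm ε) x

/-! ### §2 The growing eigenmode: vorticity along the stretching direction, rate exactly `ε` -/

/-- **The stretching direction.** `e₁ − e₂` (the `−45°` diagonal `y = −x`) is an eigenvector of the
strain `𝒟 = strain ε` with eigenvalue `+ε`; `e₁ + e₂` has eigenvalue `−ε`.
[cite: Kerswell2002, §2.1 p. 86 ("stretching in the −45° direction")] -/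
theorem lin_strain_stretchDir (ε : ℝ) :
    lin (strain ε) (EuclideanSpace.single (0 : Fin 3) (1 : ℝ) - EuclideanSpace.single 1 1) =
      ε • (EuclideanSpace.single (0 : Fin 3) (1 : ℝ) - EuclideanSpace.single 1 1) := by
  ext i
  fin_cases i <;> simp [lin_apply, strain]

/-- The compressive direction `e₁ + e₂` (`+45°`): eigenvalue `−ε`.
[cite: Kerswell2002, §2.1 p. 86] -/
theorem lin_strain_compressDir (ε : ℝ) :
    lin (strain ε) (EuclideanSpace.single (0 : Fin 3) (1 : ℝ) + EuclideanSpace.single 1 1) =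
      (-ε) • (EuclideanSpace.single (0 : Fin 3) (1 : ℝ) + EuclideanSpace.single 1 1) := by
  ext i
  fin_cases i <;> simp [lin_apply, strain]

/-- **Waleffe's growing eigenmode of (2.2)**: `ω(t) = c e^{εt} (e₁ − e₂)` (`ω₁ = −ω₂`), the
perturbation vorticity "sitting permanently in the stretching direction".
[cite: Kerswell2002, §2.1 eq. (2.2) p. 86] -/
def solidBodyVorticity (c ε : ℝ) (t : ℝ) : EuclideanSpace ℝ (Fin 3) :=
  (c * Real.exp (ε * t)) • (EuclideanSpace.single (0 : Fin 3) (1 : ℝ) - EuclideanSpace.single 1 1)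

/-- The decaying eigenmode of (2.2): `c e^{−εt} (e₁ + e₂)` (`ω₁ = ω₂`), vorticity along the
compressive direction. [cite: Kerswell2002, §2.1 eq. (2.2) p. 86] -/
def solidBodyVorticityDecay (c ε : ℝ) (t : ℝ) : EuclideanSpace ℝ (Fin 3) :=
  (c * Real.exp (-(ε * t))) •
    (EuclideanSpace.single (0 : Fin 3) (1 : ℝ) + EuclideanSpace.single 1 1)

/-- Components: `ω(t) = (c e^{εt}, −c e^{εt}, 0)`. [cite: Kerswell2002, §2.1 eq. (2.2) p. 86] -/
theorem solidBodyVorticity_apply (c ε t : ℝ) :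
    solidBodyVorticity c ε t = !₂[c * Real.exp (ε * t), -(c * Real.exp (ε * t)), 0] := by
  ext i
  fin_cases i <;> simp [solidBodyVorticity]

/-- **The growing mode solves (2.2)**: `ω̇ = 𝒟 ω`, i.e. `ω̇₁ = −εω₂ = εω₁`, `ω̇₂ = −εω₁ = −ε ω₂`.
[cite: Kerswell2002, §2.1 eq. (2.2) p. 86] -/
theorem hasDerivAt_solidBodyVorticity (c ε t : ℝ) :
    HasDerivAt (solidBodyVorticity c ε) (lin (strain ε) (solidBodyVorticity c ε t)) t := by
  have h : HasDerivAt (solidBodyVorticity c ε)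
      ((c * (Real.exp (ε * t) * (ε * 1))) •
        (EuclideanSpace.single (0 : Fin 3) (1 : ℝ) - EuclideanSpace.single 1 1)) t :=
    ((((hasDerivAt_id t).const_mul ε).exp).const_mul c).smul_const _
  refine h.congr_deriv ?_
  rw [solidBodyVorticity, map_smul, lin_strain_stretchDir, smul_smul]
  ring_nf

/-- The decaying mode solves (2.2) as well. [cite: Kerswell2002, §2.1 eq. (2.2) p. 86] -/
theorem hasDerivAt_solidBodyVorticityDecay (c ε t : ℝ) :
    HasDerivAt (solidBodyVorticityDecay c ε)
      (lin (strain ε) (solidBodyVorticityDecay c ε t)) t := by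
  have h : HasDerivAt (solidBodyVorticityDecay c ε)
      ((c * (Real.exp (-(ε * t)) * -(ε * 1))) •
        (EuclideanSpace.single (0 : Fin 3) (1 : ℝ) + EuclideanSpace.single 1 1)) t :=
    ((((hasDerivAt_id t).const_mul ε).neg.exp).const_mul c).smul_const _
  refine h.congr_deriv ?_
  rw [solidBodyVorticityDecay, map_smul, lin_strain_compressDir, smul_smul]
  ring_nf

/-- **Growth rate EXACTLY `ε`**: `‖ω(t)‖ = √2 · |c| · e^{εt}`.
[cite: Kerswell2002, §2.1 eq. (2.2) p. 86 ("growth rate ε")] -/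
theorem norm_solidBodyVorticity (c ε t : ℝ) :
    ‖solidBodyVorticity c ε t‖ = Real.sqrt 2 * |c| * Real.exp (ε * t) := by
  have hdir : ‖(EuclideanSpace.single (0 : Fin 3) (1 : ℝ) - EuclideanSpace.single 1 1)‖ =
      Real.sqrt 2 := by
    rw [EuclideanSpace.norm_eq, Fin.sum_univ_three]
    congr 1
    simp
    norm_num
  rw [solidBodyVorticity, norm_smul, hdir, Real.norm_eq_abs, abs_mul, abs_of_pos (Real.exp_pos _)]
  ring

/-- The decaying mode: `‖c e^{−εt}(e₁ + e₂)‖ = √2 · |c| · e^{−εt}`.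
[cite: Kerswell2002, §2.1 eq. (2.2) p. 86] -/
theorem norm_solidBodyVorticityDecay (c ε t : ℝ) :
    ‖solidBodyVorticityDecay c ε t‖ = Real.sqrt 2 * |c| * Real.exp (-(ε * t)) := by
  have hdir : ‖(EuclideanSpace.single (0 : Fin 3) (1 : ℝ) + EuclideanSpace.single 1 1)‖ =
      Real.sqrt 2 := by
    rw [EuclideanSpace.norm_eq, Fin.sum_univ_three]
    congr 1
    simp
    norm_num
  rw [solidBodyVorticityDecay, norm_smul, hdir, Real.norm_eq_abs, abs_mul,
    abs_of_pos (Real.exp_pos _)]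
  ring

/-! ### §3 The exact Navier–Stokes solution carrying the growing mode -/

/-- **The total vorticity of Waleffe's solution**: `2γ e₃ + c e^{εt}(e₁ − e₂)`.
[cite: Kerswell2002, §2.1 eqs. (2.1)–(2.2) p. 86] -/
def solidBodyTotalVorticity (γ c ε : ℝ) (t : ℝ) : EuclideanSpace ℝ (Fin 3) :=
  (2 * γ) • EuclideanSpace.single (2 : Fin 3) (1 : ℝ) + solidBodyVorticity c ε t

/-- **Waleffe's exact solution, velocity**: `U(x) + ½ ω(t) × x` with `ω(t) = c e^{εt}(e₁ − e₂)` — in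
Majda–Bertozzi's form `½ (2γe₃ + ω(t)) × x + 𝒟 x`. [cite: Kerswell2002, §2.1 eqs. (2.1)–(2.2) p. 86] -/
def solidBodyFlow (γ c ε : ℝ) : ℝ → EuclideanSpace ℝ (Fin 3) → EuclideanSpace ℝ (Fin 3) :=
  velocity (fun _ => strain ε) (solidBodyTotalVorticity γ c ε)

/-- **Waleffe's exact solution, pressure**: Majda–Bertozzi's `−½⟪(𝒟² + Ω(t)²)x, x⟫` (1.24) with
`Ω(t) h = ½ (2γe₃ + ω(t)) × h` (`𝒟_t = 0`). [cite: Kerswell2002, §2.1 eqs. (2.1)–(2.2) p. 86; MajdaBertozziCUP2002, §1.4 Prop. 1.5 eq. (1.24)] -/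
def solidBodyPressure (γ c ε : ℝ) : ℝ → EuclideanSpace ℝ (Fin 3) → ℝ :=
  pressure (fun _ => strain ε) (solidBodyTotalVorticity γ c ε)

/-- `solidBodyFlow γ c ε t x = baseVelocity γ ε x + ½ ω(t) × x` — the strained vortex plus the
growing solid-body rotation. [cite: Kerswell2002, §2.1 eqs. (2.1)–(2.2) p. 86] -/
theorem solidBodyFlow_eq (γ c ε t : ℝ) (x : EuclideanSpace ℝ (Fin 3)) :
    solidBodyFlow γ c ε t x = baseVelocity γ ε x + (1 / 2 : ℝ) • cross (solidBodyVorticity c ε t) x :=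
  velocity_baseVorticity_add γ ε (solidBodyVorticity c ε) t x

/-- **Kerswell 2002 (2.2) in the kernel: Waleffe's solid-body mode on the strained vortex is an
exact classical Navier–Stokes solution on `ℝ × ℝ³`, for EVERY viscosity `ν`** (and Euler, `ν = 0`),
every rotation rate `γ`, strain `ε` and amplitude `c`. [cite: Kerswell2002, §2.1 eqs. (2.1)–(2.2) p. 86; MajdaBertozziCUP2002, §1.4 Prop. 1.5 eqs. (1.23)–(1.24)] -/
theorem isClassicalNSSolutionOn_solidBodyFlow (γ c ε ν : ℝ) :
    IsClassicalNSSolutionOn univ ν 0 (solidBodyFlow γ c ε) (solidBodyPressure γ c ε) :=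
  isClassicalNSSolutionOn_baseVelocity_add_solidBody γ ε ν (hasDerivAt_solidBodyVorticity c ε)

/-- The vorticity of Waleffe's solution: `curl u(t, ·) ≡ 2γ e₃ + c e^{εt}(e₁ − e₂)` (uniform in
space). [cite: Kerswell2002, §2.1 eqs. (2.1)–(2.2) p. 86] -/
theorem curl_solidBodyFlow (γ c ε t : ℝ) (x : EuclideanSpace ℝ (Fin 3)) :
    curl (solidBodyFlow γ c ε t) x =
      (2 * γ) • EuclideanSpace.single (2 : Fin 3) (1 : ℝ) + solidBodyVorticity c ε t :=
  curl_baseVelocity_add_solidBody γ ε (solidBodyVorticity c ε) t x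

/-- **The perturbation vorticity of the exact solution grows at the full strain rate**: at every
point `x` and every time `t`, `‖curl u(t, x) − curl U(x)‖ = √2 |c| e^{εt}` — "growth rate `ε` whose
vorticity sits permanently in the stretching direction". Compare the Kelvin-mode ceiling
`IsKelvinMode.norm_le_exp` (rate `≤ ε`) and optimum `NineSixteenthsLaw_holds` (rate `(9/16)ε + o(ε)`)
for BOUNDED plane-wave perturbations of the same flow. [cite: Kerswell2002, §2.1 eq. (2.2) p. 86] -/
theorem norm_curl_solidBodyFlow_sub_curl_base (γ c ε t : ℝ) (x : EuclideanSpace ℝ (Fin 3)) :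
    ‖curl (solidBodyFlow γ c ε t) x - curl (baseVelocity γ ε) x‖ =
      Real.sqrt 2 * |c| * Real.exp (ε * t) := by
  rw [curl_solidBodyFlow, curl_baseVelocity, add_sub_cancel_left, norm_solidBodyVorticity]

/-- The perturbation vorticity is ALIGNED with the stretching eigenvector at all times:
`𝒟 (curl u(t,x) − curl U(x)) = ε (curl u(t,x) − curl U(x))`.
[cite: Kerswell2002, §2.1 eq. (2.2) p. 86 ("sits permanently in the stretching direction")] -/
theorem lin_strain_curl_solidBodyFlow_sub (γ c ε t : ℝ) (x : EuclideanSpace ℝ (Fin 3)) :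
    lin (strain ε) (curl (solidBodyFlow γ c ε t) x - curl (baseVelocity γ ε) x) =
      ε • (curl (solidBodyFlow γ c ε t) x - curl (baseVelocity γ ε) x) := by
  rw [curl_solidBodyFlow, curl_baseVelocity, add_sub_cancel_left, solidBodyVorticity, map_smul,
    lin_strain_stretchDir, smul_comm]

/-- At `t = 0` the perturbation has size `√2 |c|`, so the amplification factor at time `t` is
EXACTLY `e^{εt}`: `‖ω(t)‖ = ‖ω(0)‖ e^{εt}`. [cite: Kerswell2002, §2.1 eq. (2.2) p. 86] -/
theorem norm_solidBodyVorticity_eq_mul_exp (c ε t : ℝ) :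
    ‖solidBodyVorticity c ε t‖ = ‖solidBodyVorticity c ε 0‖ * Real.exp (ε * t) := by
  rw [norm_solidBodyVorticity, norm_solidBodyVorticity, mul_zero, Real.exp_zero, mul_one]

end EllipticalInstability

end Literature.Analysis.FluidPDE
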